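import Mathlib.InformationTheory.Hamming
import Mathlib.Analysis.SpecialFunctions.Pow.Real
import Literature.Computability.Complexity.Circuit
import Literature.Computability.Complexity.ConstantDepth
import Literature.Computability.Cryptography.StatisticalDistance
import HarnessLib

/-!
# Bounded-depth circuits cannot sample good codes (Lovett–Viola 2012, Thm. 1.1)

Named fact (D-0014) grounding the "sampler ladder" of route `PneNP/CanonicalForms`: support item
`Summit.PneNP.PneNP.Theses.CanonicalForms.KerNC0NotCFAC0` (rung 1) is, per the route text,
Lovett–Viola Thm. 1.1 ∘ the sampler identity (`…CanonicalForms.SamplerIdentity`: an AC⁰ canonical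
form `c` for the coset relation of a linear code `C = ker H` yields the EXACT sampler
`x ↦ x ⊕ c x` of the uniform distribution on `C`, of the same depth up to `O(1)` and size up to
`O(n)`) ∘ the existence of asymptotically good codes with constant-weight parity checks
(Gallager 1963; Sipser–Spielman 1996); crux `…CanonicalForms.KerAC0NotCFParity` (rung 2, AC⁰[⊕]
canonizers) is NOT covered by any printed sampling lower bound (the 2026 state of the art for
algebraic samplers is degree-`d` `𝔽₂`-polynomial maps against non-dyadic product targets,
Khodabandeh–Shinkar arXiv:2605.00995; uniform distributions on LINEAR codes are exactly
samplable by parities).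

Lovett–Viola, *Bounded-depth circuits cannot sample good codes*, Comput. Complexity 21 (2012)
245–266 (= ECCC TR10-115; author copy read), Theorem 1.1 (p. 2): "Let `F : {0,1}^m → {0,1}^n`
be a function computable by an AC⁰ circuit of depth `t` and size `M`. Let `C ⊂ {0,1}^n` be an
`(n, k, d)`-code. Then `sd(F(U_m), U_C) ≥ 1 − O((n/(dk)) · log^{t−1} M)^{1/3}`. In particular, if
`C` is a good code, `t = O(1)`, and `M = poly(n)` then `sd(F(U_m), U_C) ≥ 1 − 1/n^{Ω(1)}`." Here
an `(n, k, d)` code is ANY subset `C ⊆ {0,1}^n` with `|C| = 2^k` and pairwise Hamming distance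
`≥ d` (linearity is not assumed), `U_m`/`U_C` are the uniform distributions and `sd` is the
statistical (total variation) distance (the tree's `PMF.tvDist`).

## Rendering (the fact is implied by the printed theorem)

* The tree's circuits (`Circuit ι`, `ConstantDepth.lean`) are single-output, so "computable by
  an AC⁰ circuit of depth `t` and size `M`" is rendered PER OUTPUT BIT (`AC0ComputesVec F t M`:
  each `x ↦ F x i` has a circuit over `acBasis` with `acDepth ≤ t`, `size ≤ M`). `n` such
  circuits merge into one multi-output circuit of size `≤ n·M`; the tree's `acDepth` does not
  count negations, and pushing negations to the inputs at most doubles the size, so the printed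
  bound is invoked with size `2·n·M` (still `poly(n)` when `M = q(n)`).
* ONE fact is minted (D-0026: the quantitative bound and its "in particular" clause are one
  theorem): `lovettViola_goodCodes`, the printed "in particular" clause in the weak eventual
  form actually used by the route — for constant depth `t`, polynomial size `q(n)` and
  rate/distance `≥ ρn`, for all large `n` the output distribution is at distance `≥ 1/2` from
  `U_C` — so no such circuit family samples `U_C` exactly. It follows from the quantitative
  bound since `(n/(dk)) · log^{t−1}(2n·q(n)) ≤ polylog(n)/(ρ² n) → 0`, the threshold depending
  on `t, q, ρ` only.

## References

* S. Lovett, E. Viola, *Bounded-depth circuits cannot sample good codes*, Comput. Complexity 21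
  (2012) 245–266, doi:10.1007/s00037-012-0039-3; ECCC TR10-115 [LovettViola2012].
* E. Viola, *The complexity of distributions*, SIAM J. Comput. 41 (2012) 191–218,
  doi:10.1137/100814998 [Viola2012].
-/

namespace Literature.Computability.Complexity

open _root_.Computability

/-! ### Notions -/

/-- The distribution SAMPLED by `F : {0,1}^m → {0,1}^n` on uniform input bits, `F(U_m)`.
[Lovett–Viola 2012, §1; Viola 2012, §1] [cite: LovettViola2012, §1 (sampling a distribution)] -/
noncomputable def sampledDist {m n : ℕ} (F : (Fin m → Bool) → (Fin n → Bool)) : PMF (Fin n → Bool) :=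
  (PMF.uniformOfFintype (Fin m → Bool)).map F

/-- `C ⊆ {0,1}^n` is an `(n, k, d)`-code: `|C| = 2^k` and distinct codewords are at Hamming
distance `≥ d` (no linearity assumed). [Lovett–Viola 2012, §1 (before Thm. 1.1)] [cite: LovettViola2012, §1 (definition of (n,k,d) code)] -/
def IsNKDCode {n : ℕ} (C : Finset (Fin n → Bool)) (k d : ℕ) : Prop :=
  C.card = 2 ^ k ∧ ∀ x ∈ C, ∀ y ∈ C, x ≠ y → d ≤ hammingDist x y

/-- `F : {0,1}^m → {0,1}^n` is computed, output bit by output bit, by unbounded fan-in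
`∧/∨/¬` circuits of depth `≤ t` (negations free, `Circuit.acDepth`) and size `≤ M` each.
[Lovett–Viola 2012, Thm. 1.1 (hypothesis), per-output rendering] [cite: LovettViola2012, Thm. 1.1 (hypothesis)] -/
def AC0ComputesVec {m n : ℕ} (F : (Fin m → Bool) → (Fin n → Bool)) (t M : ℕ) : Prop :=
  ∀ i : Fin n, ∃ C : Circuit (Fin m),
    C.IsOver acBasis ∧ C.acDepth ≤ t ∧ C.size ≤ M ∧ C.Computes (fun x => F x i)

/-! ### Named facts -/

/-- **Lovett–Viola 2012, Theorem 1.1 (small AC⁰ circuits cannot sample codes)**, vendored in the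
form of its printed "in particular" clause ("if `C` is a good code, `t = O(1)`, and `M = poly(n)`
then `sd(F(U_m), U_C) ≥ 1 − 1/n^{Ω(1)}`"; the quantitative bound printed first is
`sd(F(U_m), U_C) ≥ 1 − O((n/(dk)) · log^{t−1} M)^{1/3}` for one multi-output depth-`t` size-`M`
circuit), as the weak eventual statement the route consumes: for every depth `t`, size polynomial
`q` and rate/distance constant `ρ > 0`, for all large `n`, every `F : {0,1}^m → {0,1}^n` computed
per output bit by depth-`t` AC⁰ circuits of size `≤ q(n)` (one circuit of size `≤ 2n·q(n)` after
merging and pushing negations down, still `poly(n)`) and every `(n, k, d)`-code with `k, d ≥ ρn`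
satisfy `sd(F(U_m), U_C) ≥ 1/2` (indeed `(n/(dk)) · log^{t−1}(2n·q(n)) ≤ polylog(n)/(ρ²n) → 0`);
in particular no such `F` samples `U_C` exactly (`lovettViola_goodCodes.not_exact`). Consumed by
rung 1 of route PneNP/CanonicalForms (`Summit.PneNP.PneNP.Theses.CanonicalForms.KerNC0NotCFAC0`).
[cite: LovettViola2012, Thm. 1.1 (with its "in particular" clause, p. 2)] -/
def lovettViola_goodCodes : Prop :=
  ∀ (t : ℕ) (q : Polynomial ℕ) (ρ : ℝ), 0 < ρ → ∀ᶠ n : ℕ in Filter.atTop,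
    ∀ (m k d : ℕ) (F : (Fin m → Bool) → (Fin n → Bool)) (C : Finset (Fin n → Bool))
      (hC : C.Nonempty),
      IsNKDCode C k d → ρ * n ≤ k → ρ * n ≤ d → AC0ComputesVec F t (q.eval n) →
        (1 : ℝ) / 2 ≤ (sampledDist F).tvDist (PMF.uniformOfFinset C hC)

/-- An exact sampler has statistical distance `0`, so under `lovettViola_goodCodes` no
constant-depth polynomial-size AC⁰ map samples the uniform distribution on a good code exactly
(eventually in `n`). [cite: LovettViola2012, Thm. 1.1 ("in particular")] -/
theorem lovettViola_goodCodes.not_exact (h : lovettViola_goodCodes) (t : ℕ) (q : Polynomial ℕ)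
    {ρ : ℝ} (hρ : 0 < ρ) :
    ∀ᶠ n : ℕ in Filter.atTop, ∀ (m k d : ℕ) (F : (Fin m → Bool) → (Fin n → Bool))
      (C : Finset (Fin n → Bool)) (hC : C.Nonempty),
      IsNKDCode C k d → ρ * n ≤ k → ρ * n ≤ d → AC0ComputesVec F t (q.eval n) →
        sampledDist F ≠ PMF.uniformOfFinset C hC := by
  filter_upwards [h t q ρ hρ] with n hn m k d F C hC hcode hk hd hF heq
  have := hn m k d F C hC hcode hk hd hF
  rw [heq, PMF.tvDist_self] at this
  norm_num at this

end Literature.Computability.Complexity
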